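import Summits.AtomisticToContinuum.HydrodynamicLimit.Theses.JParityClosure
import Summits.AtomisticToContinuum.HydrodynamicLimit.Theses.ExpTailStaging
import Literature.Barriers.AtomisticToContinuum.HighMomentumCutoff
import HarnessLib

/-!
# `JParityClosure.KineticEnergyTails` (stmt-AtomisticToContinuum-13087): the three reductions

The support item `KineticEnergyTails` of route `JParityClosure` asks for UNIFORM INTEGRABILITY OF
THE KINETIC ENERGY along the true hard-sphere flow, in expectation under the local Gibbs law,
uniformly in the particle number and in the time `s ∈ [0, t]` before the first shock:
`∀ t < T ∀ ε > 0 ∃ M ∃ N₀ ∀ N ≥ N₀ ∀ s ∈ [0,t], 𝔼[(N+1)⁻¹ ∑ᵢ |vᵢ(s)|² 𝟙{|vᵢ(s)| > M}] ≤ ε`.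

As a stand-alone input this is an OPEN a-priori estimate for deterministic hard spheres at fixed
reduced density (the planner's docstring and the grounders agree: pathwise energy conservation
bounds the MEAN kinetic energy only, and the relative entropy with respect to any flow-invariant
reference is extensive, so the entropy inequality floors at a constant; Olla–Varadhan–Yau 1993
modify the kinetic energy precisely to avoid it, Nachtergaele–Yau 2003 assume the Gaussian
moment bound II.1). This file records, sorry-free, the three implications that place the item at
the BOTTOM of the tree's lattice of large-velocity inputs:

* `kineticEnergyTails_of_energyCurrentTails` — the cubic sibling `EnergyCurrentTails`
  (stmt-AtomisticToContinuum-9235, shared by seven routes; taken here as the decl of route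
  `ExpTailStaging` — every other route's copy has the same body and feeds the theorem by
  unfolding) implies it: on `{|v| > max M 1}` one has `|v|² ≤ |v|³`, and the tail functional is
  monotone in the cut-off.
* `kineticEnergyTails_of_expVelocityMomentBound` — an `N`-uniform exponential velocity-moment
  rate along the flow (`ExpTailStaging.ExpVelocityMomentBound`, stmt-AtomisticToContinuum-11518)
  implies it: `|v|² 𝟙{|v| > M} ≤ δ e^{κ|v|}` once `M ≥ max 1 (6/(δκ³))`.
* `kineticEnergyTails_of_highMomentumCutoff` — the catalogued open hypothesis
  `Literature.Barriers.AtomisticToContinuum.HighMomentumCutoff σ` (Nachtergaele–Yau's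
  high-momentum cutoff II.1 transcribed to hard spheres) for all small `σ` implies it:
  `|v|² 𝟙{|v| > M} ≤ δ e^{c|v|²}` once `M ≥ max 1 (2/(δc²))`.

In each case the Euler solution and the `t = 0` law of large numbers in the hypotheses of the item
are not used: the implications are pointwise domination of the integrand followed by monotonicity
and linearity of the lower Lebesgue integral (no measurability is needed).

References: S. Olla, S. R. S. Varadhan, H.-T. Yau, Comm. Math. Phys. 155 (1993), §1 p. 525;
B. Nachtergaele, H.-T. Yau, Comm. Math. Phys. 243 (2003), §2.3 Assumption II.1; H. Spohn,
*Large Scale Dynamics of Interacting Particles* (1991), Part I Ch. 3.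
-/

noncomputable section

namespace Summit.AtomisticToContinuum.HydrodynamicLimit.Theorems

open MeasureTheory Set
open scoped ENNReal BigOperators
open Literature.MathematicalPhysics.KineticTheory Literature.Analysis.FluidPDE
open Summit.AtomisticToContinuum.HydrodynamicLimit.Theses.JParityClosure

/-! ### Pointwise tail inequalities -/

/-- On `{|v| > max M 1}` the square is below the cube: the quadratic tail functional at cut-off
`max M 1` is dominated by the cubic one at cut-off `M` (and both vanish off the tail). -/
theorem indicator_sq_le_indicator_cube (M : ℝ) (v : V3) :
    Set.indicator {w : V3 | max M 1 < ‖w‖} (fun w => ‖w‖ ^ 2) v ≤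
      Set.indicator {w : V3 | M < ‖w‖} (fun w => ‖w‖ ^ 3) v := by
  by_cases hv : max M 1 < ‖v‖
  · have hM : M < ‖v‖ := lt_of_le_of_lt (le_max_left _ _) hv
    have h1 : 1 < ‖v‖ := lt_of_le_of_lt (le_max_right _ _) hv
    rw [Set.indicator_of_mem (show v ∈ {w : V3 | max M 1 < ‖w‖} from hv),
      Set.indicator_of_mem (show v ∈ {w : V3 | M < ‖w‖} from hM)]
    calc ‖v‖ ^ 2 = ‖v‖ ^ 2 * 1 := (mul_one _).symm
      _ ≤ ‖v‖ ^ 2 * ‖v‖ := mul_le_mul_of_nonneg_left h1.le (sq_nonneg _)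
      _ = ‖v‖ ^ 3 := by ring
  · rw [Set.indicator_of_notMem (show v ∉ {w : V3 | max M 1 < ‖w‖} from hv)]
    exact Set.indicator_nonneg (fun w _ => pow_nonneg (norm_nonneg w) 3) v

/-- Gaussian domination of the quadratic tail: for `c, δ > 0` and `r > max 1 (2/(δc²))`,
`r² ≤ δ exp(c r²)` (from `x²/2 ≤ eˣ` at `x = c r²`). -/
theorem sq_le_mul_exp_sq_of_lt {c δ r : ℝ} (hc : 0 < c) (hδ : 0 < δ)
    (hr : max 1 (2 / (δ * c ^ 2)) < r) : r ^ 2 ≤ δ * Real.exp (c * r ^ 2) := by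
  have h1 : 1 < r := lt_of_le_of_lt (le_max_left _ _) hr
  have h2 : 2 / (δ * c ^ 2) < r := lt_of_le_of_lt (le_max_right _ _) hr
  have hdc : 0 < δ * c ^ 2 := by positivity
  have hr2 : 2 / (δ * c ^ 2) < r ^ 2 := h2.trans_le (by nlinarith)
  have hkey : 2 < δ * c ^ 2 * r ^ 2 := by
    rw [div_lt_iff₀ hdc] at hr2
    linarith
  have hexp : (c * r ^ 2) ^ 2 / 2 ≤ Real.exp (c * r ^ 2) := by
    have h := Real.pow_div_factorial_le_exp (x := c * r ^ 2) (by positivity) 2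
    simpa [Nat.factorial] using h
  calc r ^ 2 = 1 * r ^ 2 := (one_mul _).symm
    _ ≤ (δ * c ^ 2 * r ^ 2 / 2) * r ^ 2 := by gcongr; linarith
    _ = δ * ((c * r ^ 2) ^ 2 / 2) := by ring
    _ ≤ δ * Real.exp (c * r ^ 2) := by gcongr

/-- Exponential domination of the quadratic tail: for `κ, δ > 0` and `r > max 1 (6/(δκ³))`,
`r² ≤ δ exp(κ r)` (from `x³/6 ≤ eˣ` at `x = κ r`). -/
theorem sq_le_mul_exp_of_lt {κ δ r : ℝ} (hκ : 0 < κ) (hδ : 0 < δ)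
    (hr : max 1 (6 / (δ * κ ^ 3)) < r) : r ^ 2 ≤ δ * Real.exp (κ * r) := by
  have h1 : 1 < r := lt_of_le_of_lt (le_max_left _ _) hr
  have h2 : 6 / (δ * κ ^ 3) < r := lt_of_le_of_lt (le_max_right _ _) hr
  have hdc : 0 < δ * κ ^ 3 := by positivity
  have hkey : 6 < δ * κ ^ 3 * r := by
    rw [div_lt_iff₀ hdc] at h2
    linarith
  have hr0 : 0 < r := by linarith
  have hexp : (κ * r) ^ 3 / 6 ≤ Real.exp (κ * r) := by
    have h := Real.pow_div_factorial_le_exp (x := κ * r) (by positivity) 3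
    simpa [Nat.factorial] using h
  calc r ^ 2 = 1 * r ^ 2 := (one_mul _).symm
    _ ≤ (δ * κ ^ 3 * r / 6) * r ^ 2 := by gcongr; linarith
    _ = δ * ((κ * r) ^ 3 / 6) := by ring
    _ ≤ δ * Real.exp (κ * r) := by gcongr

/-- Indicator form of `sq_le_mul_exp_sq_of_lt`: the quadratic tail at the Gaussian cut-off is
below `δ e^{c|v|²}` everywhere. -/
theorem indicator_sq_le_mul_exp_sq {c δ : ℝ} (hc : 0 < c) (hδ : 0 < δ) (v : V3) :
    Set.indicator {w : V3 | max 1 (2 / (δ * c ^ 2)) < ‖w‖} (fun w => ‖w‖ ^ 2) v ≤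
      δ * Real.exp (c * ‖v‖ ^ 2) := by
  by_cases hv : max 1 (2 / (δ * c ^ 2)) < ‖v‖
  · rw [Set.indicator_of_mem (show v ∈ {w : V3 | max 1 (2 / (δ * c ^ 2)) < ‖w‖} from hv)]
    exact sq_le_mul_exp_sq_of_lt hc hδ hv
  · rw [Set.indicator_of_notMem (show v ∉ {w : V3 | max 1 (2 / (δ * c ^ 2)) < ‖w‖} from hv)]
    positivity

/-- Indicator form of `sq_le_mul_exp_of_lt`: the quadratic tail at the exponential cut-off is
below `δ e^{κ|v|}` everywhere. -/
theorem indicator_sq_le_mul_exp {κ δ : ℝ} (hκ : 0 < κ) (hδ : 0 < δ) (v : V3) :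
    Set.indicator {w : V3 | max 1 (6 / (δ * κ ^ 3)) < ‖w‖} (fun w => ‖w‖ ^ 2) v ≤
      δ * Real.exp (κ * ‖v‖) := by
  by_cases hv : max 1 (6 / (δ * κ ^ 3)) < ‖v‖
  · rw [Set.indicator_of_mem (show v ∈ {w : V3 | max 1 (6 / (δ * κ ^ 3)) < ‖w‖} from hv)]
    exact sq_le_mul_exp_of_lt hκ hδ hv
  · rw [Set.indicator_of_notMem (show v ∉ {w : V3 | max 1 (6 / (δ * κ ^ 3)) < ‖w‖} from hv)]
    positivity

/-! ### Reduction 1: the cubic sibling `EnergyCurrentTails` implies `KineticEnergyTails` -/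

/-- **`EnergyCurrentTails ⇒ KineticEnergyTails`.** The hypothesis is the shared cubic item
`EnergyCurrentTails` (stmt-AtomisticToContinuum-9235) as declared in route `ExpTailStaging` (the
decls of the six other routes wanting it have the same body and feed this theorem by unfolding).
Given the cubic `M, N₀` for `(t, ε)`, the quadratic statement holds with cut-off `max M 1` and the
same `N₀`: pointwise `indicator_sq_le_indicator_cube`, then monotonicity of the sum, of
`ENNReal.ofReal` and of the lower integral. -/
theorem kineticEnergyTails_of_energyCurrentTails
    (h : Summit.AtomisticToContinuum.HydrodynamicLimit.Theses.ExpTailStaging.EnergyCurrentTails) :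
    KineticEnergyTails := by
  intro a₀ θ₀ u₀ ha hθ hu ha0 hθ0
  obtain ⟨σ₀, hσ₀, hσ⟩ := h a₀ θ₀ u₀ ha hθ hu ha0 hθ0
  refine ⟨σ₀, hσ₀, fun σ hσp hσl T ρ θ u hE Φ hLLN t ht ε hε => ?_⟩
  obtain ⟨M, N₀, hM⟩ := hσ σ hσp hσl T ρ θ u hE Φ hLLN t ht ε hε
  refine ⟨max M 1, N₀, fun N hN s hs => le_trans (lintegral_mono fun z => ?_) (hM N hN s hs)⟩
  refine ENNReal.ofReal_le_ofReal ?_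
  exact mul_le_mul_of_nonneg_left
    (Finset.sum_le_sum fun i _ => indicator_sq_le_indicator_cube M _) (by positivity)

/-! ### Reduction 2: an exponential velocity-moment rate implies `KineticEnergyTails` -/

/-- **`ExpVelocityMomentBound ⇒ KineticEnergyTails`.** The hypothesis is the crux
`ExpTailStaging.ExpVelocityMomentBound` (stmt-AtomisticToContinuum-11518): for all small `σ`,
every horizon `T > 0` and every flow family there are `κ > 0`, `C`, `N₀` with
`∫ (N+1)⁻¹ ∑ᵢ exp(κ |vᵢ(Φ_N(t) z)|) dλ^N ≤ C` for `N ≥ N₀`, `t ∈ [0, T]`. For the item at `(t, ε)`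
apply it with horizon `t + 1`, put `δ = ε / (max C 0 + 1)` and `M = max 1 (6/(δκ³))`; then
pointwise `|v|² 𝟙{|v| > M} ≤ δ e^{κ|v|}` (`indicator_sq_le_mul_exp`), so the lower integral is at
most `δ · C ≤ ε`. -/
theorem kineticEnergyTails_of_expVelocityMomentBound
    (h : Summit.AtomisticToContinuum.HydrodynamicLimit.Theses.ExpTailStaging.ExpVelocityMomentBound) :
    KineticEnergyTails := by
  intro a₀ θ₀ u₀ ha hθ hu ha0 hθ0
  obtain ⟨σ₀, hσ₀, hσ⟩ := h a₀ θ₀ u₀ ha hθ hu ha0 hθ0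
  refine ⟨σ₀, hσ₀, fun σ hσp hσl T ρ θ u _hE Φ _hLLN t ht ε hε => ?_⟩
  obtain ⟨κ, hκ, C, N₀, hb⟩ := hσ σ hσp hσl (t + 1) (by linarith [ht.1]) Φ
  set δ : ℝ := ε / (max C 0 + 1) with hδ
  have hC1 : 0 < max C 0 + 1 := by positivity
  have hδpos : 0 < δ := div_pos hε hC1
  have hδC : δ * C ≤ ε := by
    calc δ * C ≤ δ * (max C 0 + 1) := by
          refine mul_le_mul_of_nonneg_left ?_ hδpos.le
          linarith [le_max_left C 0]
      _ = ε := by rw [hδ, div_mul_cancel₀ _ hC1.ne']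
  refine ⟨max 1 (6 / (δ * κ ^ 3)), N₀, fun N hN s hs => ?_⟩
  have hsT : s ∈ Set.Icc 0 (t + 1) := ⟨hs.1, hs.2.trans (by linarith)⟩
  have hpt : ∀ z : Config (N + 1) (Fin 3) T3,
      ENNReal.ofReal (((N : ℝ) + 1)⁻¹ * ∑ i : Fin (N + 1),
        Set.indicator {v : V3 | max 1 (6 / (δ * κ ^ 3)) < ‖v‖} (fun v => ‖v‖ ^ 2)
          (((Φ N).flow s z i).2)) ≤
      ENNReal.ofReal δ * ENNReal.ofReal (((N : ℝ) + 1)⁻¹ * ∑ i : Fin (N + 1),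
        Real.exp (κ * ‖((Φ N).flow s z i).2‖)) := by
    intro z
    rw [← ENNReal.ofReal_mul hδpos.le]
    refine ENNReal.ofReal_le_ofReal ?_
    calc ((N : ℝ) + 1)⁻¹ * ∑ i : Fin (N + 1),
          Set.indicator {v : V3 | max 1 (6 / (δ * κ ^ 3)) < ‖v‖} (fun v => ‖v‖ ^ 2)
            (((Φ N).flow s z i).2)
        ≤ ((N : ℝ) + 1)⁻¹ * ∑ i : Fin (N + 1), δ * Real.exp (κ * ‖((Φ N).flow s z i).2‖) :=
          mul_le_mul_of_nonneg_left
            (Finset.sum_le_sum fun i _ => indicator_sq_le_mul_exp hκ hδpos _) (by positivity)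
      _ = δ * (((N : ℝ) + 1)⁻¹ * ∑ i : Fin (N + 1), Real.exp (κ * ‖((Φ N).flow s z i).2‖)) := by
          rw [← Finset.mul_sum]
          ring
  calc ∫⁻ z, ENNReal.ofReal (((N : ℝ) + 1)⁻¹ * ∑ i : Fin (N + 1),
          Set.indicator {v : V3 | max 1 (6 / (δ * κ ^ 3)) < ‖v‖} (fun v => ‖v‖ ^ 2)
            (((Φ N).flow s z i).2)) ∂(localGibbsLaw σ a₀ u₀ θ₀ N (Φ N))
      ≤ ∫⁻ z, ENNReal.ofReal δ * ENNReal.ofReal (((N : ℝ) + 1)⁻¹ * ∑ i : Fin (N + 1),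
          Real.exp (κ * ‖((Φ N).flow s z i).2‖)) ∂(localGibbsLaw σ a₀ u₀ θ₀ N (Φ N)) :=
        lintegral_mono (hpt ·)
    _ = ENNReal.ofReal δ * ∫⁻ z, ENNReal.ofReal (((N : ℝ) + 1)⁻¹ * ∑ i : Fin (N + 1),
          Real.exp (κ * ‖((Φ N).flow s z i).2‖)) ∂(localGibbsLaw σ a₀ u₀ θ₀ N (Φ N)) :=
        lintegral_const_mul' _ _ ENNReal.ofReal_ne_top
    _ ≤ ENNReal.ofReal δ * ENNReal.ofReal C := mul_le_mul' le_rfl (hb N hN s hsT)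
    _ = ENNReal.ofReal (δ * C) := (ENNReal.ofReal_mul hδpos.le).symm
    _ ≤ ENNReal.ofReal ε := ENNReal.ofReal_le_ofReal hδC

/-! ### Reduction 3: the catalogued high-momentum cutoff implies `KineticEnergyTails` -/

/-- **`HighMomentumCutoff ⇒ KineticEnergyTails`.** If the open hypothesis
`Literature.Barriers.AtomisticToContinuum.HighMomentumCutoff σ` (Nachtergaele–Yau's Assumption
II.1 for hard spheres: an `N`-uniform bound `C < ∞` on `∫ (N+1)⁻¹ ∑ᵢ exp(c |vᵢ(Φ_N(t) z)|²) dλ^N`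
on every horizon) holds for all `σ` in some interval `(0, σ₁)`, then `KineticEnergyTails` holds
with `σ₀ = σ₁`: at `(t, ε)` apply the cutoff with horizon `t + 1`, put `δ = ε / (C.toReal + 1)` and
`M = max 1 (2/(δc²))`; pointwise `|v|² 𝟙{|v| > M} ≤ δ e^{c|v|²}` (`indicator_sq_le_mul_exp_sq`), so
the lower integral is at most `δ · C ≤ ε`, for every `N` (`N₀ = 0`). The Euler solution and the
`t = 0` law of large numbers are not used. -/
theorem kineticEnergyTails_of_highMomentumCutoff
    (h : ∃ σ₁ : ℝ, 0 < σ₁ ∧ ∀ σ : ℝ, 0 < σ → σ < σ₁ →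
      Literature.Barriers.AtomisticToContinuum.HighMomentumCutoff σ) :
    KineticEnergyTails := by
  intro a₀ θ₀ u₀ ha hθ hu ha0 hθ0
  obtain ⟨σ₁, hσ₁, hH⟩ := h
  refine ⟨σ₁, hσ₁, fun σ hσp hσl T ρ θ u _hE Φ _hLLN t ht ε hε => ?_⟩
  obtain ⟨c, hc, C, hC, hb⟩ :=
    hH σ hσp hσl a₀ θ₀ u₀ ha hθ hu ha0 hθ0 (t + 1) (by linarith [ht.1]) Φ
  set δ : ℝ := ε / (C.toReal + 1) with hδ
  have hC1 : 0 < C.toReal + 1 := by positivity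
  have hδpos : 0 < δ := div_pos hε hC1
  have hδC : δ * C.toReal ≤ ε := by
    calc δ * C.toReal ≤ δ * (C.toReal + 1) :=
          mul_le_mul_of_nonneg_left (by linarith) hδpos.le
      _ = ε := by rw [hδ, div_mul_cancel₀ _ hC1.ne']
  refine ⟨max 1 (2 / (δ * c ^ 2)), 0, fun N _ s hs => ?_⟩
  have hsT : s ∈ Set.Icc 0 (t + 1) := ⟨hs.1, hs.2.trans (by linarith)⟩
  have hpt : ∀ z : Config (N + 1) (Fin 3) T3,
      ENNReal.ofReal (((N : ℝ) + 1)⁻¹ * ∑ i : Fin (N + 1),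
        Set.indicator {v : V3 | max 1 (2 / (δ * c ^ 2)) < ‖v‖} (fun v => ‖v‖ ^ 2)
          (((Φ N).flow s z i).2)) ≤
      ENNReal.ofReal δ *
        Literature.Barriers.AtomisticToContinuum.expVelocityMoment c ((Φ N).flow s z) := by
    intro z
    rw [Literature.Barriers.AtomisticToContinuum.expVelocityMoment_eq,
      ← ENNReal.ofReal_mul hδpos.le]
    refine ENNReal.ofReal_le_ofReal ?_
    calc ((N : ℝ) + 1)⁻¹ * ∑ i : Fin (N + 1),
          Set.indicator {v : V3 | max 1 (2 / (δ * c ^ 2)) < ‖v‖} (fun v => ‖v‖ ^ 2)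
            (((Φ N).flow s z i).2)
        ≤ ((N : ℝ) + 1)⁻¹ * ∑ i : Fin (N + 1), δ * Real.exp (c * ‖((Φ N).flow s z i).2‖ ^ 2) :=
          mul_le_mul_of_nonneg_left
            (Finset.sum_le_sum fun i _ => indicator_sq_le_mul_exp_sq hc hδpos _) (by positivity)
      _ = δ * (((N + 1 : ℕ) : ℝ)⁻¹ * ∑ i : Fin (N + 1),
            Real.exp (c * ‖((Φ N).flow s z i).2‖ ^ 2)) := by
          rw [← Finset.mul_sum]
          push_cast
          ring
  calc ∫⁻ z, ENNReal.ofReal (((N : ℝ) + 1)⁻¹ * ∑ i : Fin (N + 1),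
          Set.indicator {v : V3 | max 1 (2 / (δ * c ^ 2)) < ‖v‖} (fun v => ‖v‖ ^ 2)
            (((Φ N).flow s z i).2)) ∂(localGibbsLaw σ a₀ u₀ θ₀ N (Φ N))
      ≤ ∫⁻ z, ENNReal.ofReal δ *
          Literature.Barriers.AtomisticToContinuum.expVelocityMoment c ((Φ N).flow s z)
          ∂(localGibbsLaw σ a₀ u₀ θ₀ N (Φ N)) := lintegral_mono (hpt ·)
    _ = ENNReal.ofReal δ * ∫⁻ z,
          Literature.Barriers.AtomisticToContinuum.expVelocityMoment c ((Φ N).flow s z)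
          ∂(localGibbsLaw σ a₀ u₀ θ₀ N (Φ N)) :=
        lintegral_const_mul' _ _ ENNReal.ofReal_ne_top
    _ ≤ ENNReal.ofReal δ * C := mul_le_mul' le_rfl (hb N s hsT)
    _ = ENNReal.ofReal δ * ENNReal.ofReal C.toReal := by rw [ENNReal.ofReal_toReal hC.ne]
    _ = ENNReal.ofReal (δ * C.toReal) := (ENNReal.ofReal_mul hδpos.le).symm
    _ ≤ ENNReal.ofReal ε := ENNReal.ofReal_le_ofReal hδC

end Summit.AtomisticToContinuum.HydrodynamicLimit.Theorems

end
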